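import Mathlib
import Summits.NavierStokesRegularity.NavierStokesRegularity.Theses.EfficiencyFloor
import Summits.NavierStokesRegularity.NavierStokesRegularity.Theorems.EfficiencyFloorProductionEfficiencyDecayLuDoeringRung
import Summits.NavierStokesRegularity.NavierStokesRegularity.Theorems.EfficiencyFloorBlowupEnstrophyUnbounded
import HarnessLib

/-!
# `EfficiencyFloor.LerayFloorGapGlue` — the glue of the g3 split of `LerayFloorGap` (item stmt-NavierStokesRegularity-25485)

**Statement.** `SharpLuDoeringBudget → NearSaturationNearMaximiser → NearMaximiserBoundedAmplification →
CoveringUpgrade → LerayFloorGap` (route `EfficiencyFloor`, planner ns-idea-5 g3, D-0145 LINE «extremiser frame»).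

PROOF (elementary; the four parts stay hypotheses). Fix the sharp one-sided Lu–Doering constant `c⋆ > 0` and its
budget (part 1), take `(A, ε)` from part 3 at `c⋆`, `δ = δ(c⋆, ε)` from part 2 and `θ = θ(δ, A) < 1` from part 4. Given
an admissible constant `c` and a maximal smooth Leray–Hopf rapidly-decaying-datum flow, let `Zr` be its real enstrophy
with derivative `D ≤ K Zr³`, `K = 27c⋆⁴/(128ν³)` (part 1). On `[t₁, T)` where `Zr ≥ 1`
(`LuDoeringRung.eventually_one_le`) apply part 4: divergence of `Zr` at `T⁻` is `Theorems.BlowupEnstrophyUnbounded.main`,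
and the window hypothesis at a `(1−δ)`-saturated instant `s` is parts 2 + 3 chained (near-saturation ⇒ `u(s)` is
`ε`-close to a normalised maximiser ⇒ amplification `≤ A` on `[s, s + (2K)⁻¹Zr(s)⁻²]`). Finally
`θ·2K·(T−t) ≤ θ·(27c⁴/(64ν³))·(T−t)` because `c⋆ ≤ c` (minimality of `c⋆` against the admissible `c`).

HONEST FRAMING: pure composition between the route's own statements; `LerayFloorGap`, its two crux parts,
`ProductionEfficiencyDecay`, the route and Navier–Stokes regularity all stay OPEN; nothing here proves a summit.
-/

noncomputable section

set_option linter.dupNamespace false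

namespace Summit.NavierStokesRegularity.NavierStokesRegularity.Theorems

open Set MeasureTheory Filter Topology
open scoped InnerProductSpace ENNReal
open Literature.Analysis.FluidPDE
open Summit.NavierStokesRegularity.NavierStokesRegularity.Theses.EfficiencyFloor
open Summit.NavierStokesRegularity.NavierStokesRegularity.Theorems.ProductionEfficiencyDecay

/-- **Item stmt-NavierStokesRegularity-25485** (`EfficiencyFloor.LerayFloorGapGlue`): the four parts of the g3 split
imply `LerayFloorGap` (an implication; its hypotheses stay hypotheses). [this file] -/
theorem lerayFloorGapGlue_proof :
    Summit.NavierStokesRegularity.NavierStokesRegularity.Theses.EfficiencyFloor.LerayFloorGapGlue := by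
  intro h1 h2 h3 h4
  obtain ⟨cs, hsharp, h1'⟩ := h1
  have hcs_pos : 0 < cs := hsharp.1
  obtain ⟨A, ε, hA, hε, h3'⟩ := h3 cs hsharp
  obtain ⟨δ, hδ, h2'⟩ := h2 cs ε hsharp hε
  obtain ⟨θ, hθ0, hθ1, h4'⟩ := h4 δ A hδ hA
  refine ⟨θ, hθ0, hθ1, ?_⟩
  intro c hc hcadm ν T hν hT u p hmax hLH hdec
  have hcsc : cs ≤ c := hsharp.2.2 c (fun v hv => hcadm v hv.1 hv.2.1 hv.2.2.1 hv.2.2.2.1 hv.2.2.2.2)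
  obtain ⟨Zr, D, hB⟩ := h1' ν T hν hT u p hmax hLH hdec
  set K : ℝ := 27 * cs ^ 4 / (128 * ν ^ 3) with hKdef
  have hK : 0 < K := by positivity
  obtain ⟨t₁, ht₁, hone⟩ := LuDoeringRung.eventually_one_le hν hT hmax hLH hdec (fun t ht => (hB t ht).1)
  have hIoo : ∀ s ∈ Set.Ico t₁ T, s ∈ Set.Ioo 0 T := fun s hs => ⟨ht₁.1.trans_le hs.1, hs.2⟩
  have hunb : ∀ N : ℝ, ∀ᶠ t in nhdsWithin T (Set.Iio T), N ≤ Zr t := by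
    intro N
    have h1N := Theorems.BlowupEnstrophyUnbounded.main hν hT hmax hLH hdec N
    have h2N : ∀ᶠ t in nhdsWithin T (Set.Iio T), t ∈ Set.Ioo 0 T := Ioo_mem_nhdsLT hT
    filter_upwards [h1N, h2N] with t hNt ht
    rw [(hB t ht).1] at hNt
    exact (ENNReal.ofReal_le_ofReal_iff (hB t ht).2.1).1 hNt
  have hgap := h4' K hK Zr D t₁ T ht₁.2
    (fun s hs => ⟨lt_of_lt_of_le one_pos (hone s hs), (hB s (hIoo s hs)).2.2.2.2.1,
      (hB s (hIoo s hs)).2.2.2.2.2.2⟩)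
    hunb
    (by
      intro s hs hsat t ht hwin
      have hsI := hIoo s hs
      obtain ⟨hZs_eq, hZs_nn, hAdm_s, hZs_ens, hder_s, hD_s, hcube_s⟩ := hB s hsI
      have htI : t ∈ Set.Ioo 0 T := ⟨hsI.1.trans_le ht.1, ht.2⟩
      obtain ⟨hZt_eq, hZt_nn, hAdm_t, hZt_ens, hder_t, hD_t, hcube_t⟩ := hB t htI
      have hpos : 0 < ∫ x, ‖curl (u s) x‖ ^ 2 := by
        rw [← hZs_ens]; exact lt_of_lt_of_le one_pos (hone s hs)
      have hKinv : (2 * K)⁻¹ = 64 * ν ^ 3 / (27 * cs ^ 4) := by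
        rw [hKdef]; field_simp; ring
      obtain ⟨m, hm, hclose⟩ := h2' ν hν (u s) hAdm_s hpos (by
        rw [← hZs_ens, ← hD_s]; simpa [hKdef] using hsat)
      have := h3' ν T hν hT u p hmax hLH hdec s hsI m hm hclose t ht (by rw [← hZs_ens, ← hKinv]; exact hwin)
      rw [← hZs_ens, ← hZt_ens] at this
      exact this)
  have hIco : ∀ᶠ t in nhdsWithin T (Set.Iio T), t ∈ Set.Ico t₁ T := Ico_mem_nhdsLT ht₁.2
  filter_upwards [hIco] with t ht
  have htI := hIoo t ht
  rw [(hB t htI).1, ENNReal.toReal_ofReal (hB t htI).2.1]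
  have h2K : 2 * K ≤ 27 * c ^ 4 / (64 * ν ^ 3) := by
    have hc4 : cs ^ 4 ≤ c ^ 4 := pow_le_pow_left₀ hcs_pos.le hcsc 4
    rw [hKdef, show 2 * (27 * cs ^ 4 / (128 * ν ^ 3)) = 27 * cs ^ 4 / (64 * ν ^ 3) by ring]
    have hν3 : 0 < 64 * ν ^ 3 := by positivity
    exact div_le_div_of_nonneg_right (by nlinarith) hν3.le
  calc (Zr t)⁻¹ ^ 2 ≤ θ * (2 * K) * (T - t) := hgap t ht
    _ ≤ θ * (27 * c ^ 4 / (64 * ν ^ 3)) * (T - t) := by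
        apply mul_le_mul_of_nonneg_right _ (sub_nonneg.2 ht.2.le)
        exact mul_le_mul_of_nonneg_left h2K hθ0

end Summit.NavierStokesRegularity.NavierStokesRegularity.Theorems

end
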